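import Mathlib
import Summits.AtomisticToContinuum.FouriersLaw.Theorems.EmbeddedDrudeMourreDrudeDissolutionFloorCritical
import Summits.AtomisticToContinuum.FouriersLaw.Theorems.EmbeddedDrudeMourreDrudeDissolutionStubExcursionSecondDifferenceConcreteRegularity
import Summits.AtomisticToContinuum.FouriersLaw.Theorems.EmbeddedDrudeMourreDrudeDissolutionGradFluxGlue
import HarnessLib

/-!
# The global gradient floor `D ≥ c·(A²S₁²+A²S₂²+S₁²S₂²)` off the corner balls
(crux `EmbeddedDrudeMourre.DrudeDissolution`, item stmt-AtomisticToContinuum-12593; `--supports` file for the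
registered sub-goal `resonance_gradient_floor` of stub B1b″ `stub_excursionSecondDifference` of line
`kinetic-polymer-gas-on-the-time-axis`; closes nothing; lead c13 (process B), 2026-08-17)

WHAT. `resonance_gradient_floor` (item (C4) of the sup-norm route): for `ω₂ > 0`, `Ω = −A·S₁·S₂` read at
`p = (k₁,(k₃,k₂))`, `D = (∂₁Ω)² + (∂₂Ω)² + (∂₃Ω)²`, `μ = A²S₁² + A²S₂² + S₁²S₂²`, and every `r₀ > 0` there is
`c > 0` such that `c·μ(p) ≤ D(p)` at every `p ∈ ℝ³` with
`r₀ ≤ (1−cos k₁)+(1−cos k₂)+(1+cos k₃)` and `r₀ ≤ (1+cos k₁)+(1+cos k₂)+(1−cos k₃)` (away from all translates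
of the two corners).

HOW. Compactness (`IsCompact.induction_on`) over the closed constraint set inside `[−π,π]³` from the local
statement `resonance_floor_local`, then `2π`-periodicity of `μ`, `D` and the constraints in each coordinate
(`floor_invariant_shift`, a `Prop`-valued `Function.Periodic` argument `forall_of_periodic3`).
-/

noncomputable section

open scoped Topology
open Filter Set

namespace Summit.AtomisticToContinuum.FouriersLaw.Theorems.DrudeDissolution.KineticPolymerGasOnTheTimeAxis

open Literature.MathematicalPhysics.KineticTheory
open Literature.MathematicalPhysics.KineticTheory.PhononBoltzmann

/-! ### A periodicity principle for predicates on `ℝ³` -/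

/-- A predicate on `ℝ³` which is invariant under the three coordinate shifts by `T > 0` and holds on the box
`[a, a+T]³` holds everywhere. [folklore] -/
theorem forall_of_periodic3 {P : ℝ × ℝ × ℝ → Prop} {T a : ℝ} (hT : 0 < T)
    (h1 : ∀ q : ℝ × ℝ × ℝ, P (q + (T, 0, 0)) ↔ P q) (h2 : ∀ q : ℝ × ℝ × ℝ, P (q + (0, T, 0)) ↔ P q)
    (h3 : ∀ q : ℝ × ℝ × ℝ, P (q + (0, 0, T)) ↔ P q)
    (hbox : ∀ q ∈ Icc a (a + T) ×ˢ (Icc a (a + T) ×ˢ Icc a (a + T)), P q) : ∀ p, P p := by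
  have i1 : ∀ (n : ℤ) (x y z : ℝ), P (x + n * T, y, z) = P (x, y, z) := fun n x y z => by
    have hper : Function.Periodic (fun s : ℝ => P (s, y, z)) T := fun s => by
      have := h1 (s, y, z); simp only [Prod.mk_add_mk, add_zero] at this; exact propext this
    exact hper.int_mul n x
  have i2 : ∀ (n : ℤ) (x y z : ℝ), P (x, y + n * T, z) = P (x, y, z) := fun n x y z => by
    have hper : Function.Periodic (fun s : ℝ => P (x, s, z)) T := fun s => by
      have := h2 (x, s, z); simp only [Prod.mk_add_mk, add_zero] at this; exact propext this
    exact hper.int_mul n y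
  have i3 : ∀ (n : ℤ) (x y z : ℝ), P (x, y, z + n * T) = P (x, y, z) := fun n x y z => by
    have hper : Function.Periodic (fun s : ℝ => P (x, y, s)) T := fun s => by
      have := h3 (x, y, s); simp only [Prod.mk_add_mk, add_zero] at this; exact propext this
    exact hper.int_mul n z
  have red : ∀ x : ℝ, ∃ n : ℤ, x - n * T ∈ Icc a (a + T) := fun x => by
    refine ⟨⌊(x - a) / T⌋, ?_, ?_⟩
    · have h := Int.floor_le ((x - a) / T)
      have : (⌊(x - a) / T⌋ : ℝ) * T ≤ x - a := by rwa [le_div_iff₀ hT] at h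
      linarith
    · have h := Int.lt_floor_add_one ((x - a) / T)
      have : x - a < ((⌊(x - a) / T⌋ : ℝ) + 1) * T := by rwa [div_lt_iff₀ hT] at h
      nlinarith
  intro p
  obtain ⟨x, y, z⟩ := p
  obtain ⟨n₁, hn₁⟩ := red x
  obtain ⟨n₂, hn₂⟩ := red y
  obtain ⟨n₃, hn₃⟩ := red z
  have hmem : ((x - n₁ * T, y - n₂ * T, z - n₃ * T) : ℝ × ℝ × ℝ) ∈
      Icc a (a + T) ×ˢ (Icc a (a + T) ×ˢ Icc a (a + T)) := ⟨hn₁, hn₂, hn₃⟩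
  have hval : P (x, y, z) = P (x - n₁ * T, y - n₂ * T, z - n₃ * T) := by
    have e1 := i1 n₁ (x - n₁ * T) (y - n₂ * T) (z - n₃ * T)
    have e2 := i2 n₂ x (y - n₂ * T) (z - n₃ * T)
    have e3 := i3 n₃ x y (z - n₃ * T)
    simp only [sub_add_cancel] at e1 e2 e3
    rw [e3, e2, e1]
  rw [hval]
  exact hbox _ hmem

/-! ### Shift invariance of `μ` -/

section Structure

variable {ω₂ : ℝ} {A S₁ S₂ : ℝ × ℝ × ℝ → ℝ}
  (hS₁ : ∀ p : ℝ × ℝ × ℝ, S₁ p = Real.sin ((p.2.1 - p.1) / 2))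
  (hS₂ : ∀ p : ℝ × ℝ × ℝ, S₂ p = Real.sin ((p.2.1 - p.2.2) / 2))
  (hA : ∀ p : ℝ × ℝ × ℝ, A p =
    8 * ((dispersion ω₂ p.1 * dispersion ω₂ p.2.2 +
            dispersion ω₂ p.2.1 * dispersion ω₂ (p.1 + p.2.2 - p.2.1) + 2 * (ω₂ + 2)) *
          Real.cos ((p.1 + p.2.2) / 2) -
        4 * Real.cos ((p.2.1 - p.1) / 2) * Real.cos ((p.2.2 - p.2.1) / 2)) /
      ((dispersion ω₂ p.1 + dispersion ω₂ p.2.2 + dispersion ω₂ p.2.1 + dispersion ω₂ (p.1 + p.2.2 - p.2.1)) *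
        (dispersion ω₂ p.1 * dispersion ω₂ p.2.2 + dispersion ω₂ p.2.1 * dispersion ω₂ (p.1 + p.2.2 - p.2.1))))

include hS₁ hS₂ hA in
/-- Under each coordinate shift by `2π` the three factors `A`, `S₁`, `S₂` change at most by a sign:
shift in `k₁`: `(A,S₁,S₂) ↦ (−A,−S₁,S₂)`; in `k₃`: `(A,−S₁,−S₂)`; in `k₂`: `(−A,S₁,−S₂)`. [folklore] -/
theorem floor_factor_shift (q : ℝ × ℝ × ℝ) :
    (A (q + (2 * Real.pi, 0, 0)) = -A q ∧ S₁ (q + (2 * Real.pi, 0, 0)) = -S₁ q ∧ S₂ (q + (2 * Real.pi, 0, 0)) = S₂ q) ∧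
    (A (q + (0, 2 * Real.pi, 0)) = A q ∧ S₁ (q + (0, 2 * Real.pi, 0)) = -S₁ q ∧ S₂ (q + (0, 2 * Real.pi, 0)) = -S₂ q) ∧
    (A (q + (0, 0, 2 * Real.pi)) = -A q ∧ S₁ (q + (0, 0, 2 * Real.pi)) = S₁ q ∧ S₂ (q + (0, 0, 2 * Real.pi)) = -S₂ q) := by
  have hper := dispersion_periodic ω₂
  obtain ⟨x, y, z⟩ := q
  simp only [Prod.mk_add_mk, add_zero]
  refine ⟨⟨?_, ?_, ?_⟩, ⟨?_, ?_, ?_⟩, ⟨?_, ?_, ?_⟩⟩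
  · rw [hA, hA]; simp only
    rw [show x + 2 * Real.pi + z - y = (x + z - y) + 2 * Real.pi by ring, hper, hper,
      show (x + 2 * Real.pi + z) / 2 = (x + z) / 2 + Real.pi by ring, Real.cos_add_pi,
      show (y - (x + 2 * Real.pi)) / 2 = (y - x) / 2 - Real.pi by ring, Real.cos_sub_pi]
    ring
  · rw [hS₁, hS₁]; simp only
    rw [show (y - (x + 2 * Real.pi)) / 2 = (y - x) / 2 - Real.pi by ring, Real.sin_sub_pi]
  · rw [hS₂, hS₂]
  · rw [hA, hA]; simp only
    rw [show x + z - (y + 2 * Real.pi) = (x + z - y) - 2 * Real.pi by ring, hper.sub_eq, hper,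
      show (y + 2 * Real.pi - x) / 2 = (y - x) / 2 + Real.pi by ring, Real.cos_add_pi,
      show (z - (y + 2 * Real.pi)) / 2 = (z - y) / 2 - Real.pi by ring, Real.cos_sub_pi]
    ring
  · rw [hS₁, hS₁]; simp only
    rw [show (y + 2 * Real.pi - x) / 2 = (y - x) / 2 + Real.pi by ring, Real.sin_add_pi]
  · rw [hS₂, hS₂]; simp only
    rw [show (y + 2 * Real.pi - z) / 2 = (y - z) / 2 + Real.pi by ring, Real.sin_add_pi]
  · rw [hA, hA]; simp only
    rw [show x + (z + 2 * Real.pi) - y = (x + z - y) + 2 * Real.pi by ring, hper, hper,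
      show (x + (z + 2 * Real.pi)) / 2 = (x + z) / 2 + Real.pi by ring, Real.cos_add_pi,
      show (z + 2 * Real.pi - y) / 2 = (z - y) / 2 + Real.pi by ring, Real.cos_add_pi]
    ring
  · rw [hS₁, hS₁]
  · rw [hS₂, hS₂]; simp only
    rw [show (y - (z + 2 * Real.pi)) / 2 = (y - z) / 2 - Real.pi by ring, Real.sin_sub_pi]

include hS₁ hS₂ hA in
/-- `μ = A²S₁² + A²S₂² + S₁²S₂²` is invariant under the three coordinate shifts by `2π`. [folklore] -/
theorem floor_mu_shift (q : ℝ × ℝ × ℝ) (T : ℝ × ℝ × ℝ)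
    (hT : T = (2 * Real.pi, 0, 0) ∨ T = (0, 2 * Real.pi, 0) ∨ T = (0, 0, 2 * Real.pi)) :
    A (q + T) ^ 2 * S₁ (q + T) ^ 2 + A (q + T) ^ 2 * S₂ (q + T) ^ 2 + S₁ (q + T) ^ 2 * S₂ (q + T) ^ 2 =
      A q ^ 2 * S₁ q ^ 2 + A q ^ 2 * S₂ q ^ 2 + S₁ q ^ 2 * S₂ q ^ 2 := by
  obtain ⟨⟨a1, b1, c1⟩, ⟨a2, b2, c2⟩, ⟨a3, b3, c3⟩⟩ := floor_factor_shift hS₁ hS₂ hA q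
  rcases hT with h | h | h <;> subst h
  · rw [a1, b1, c1]; ring
  · rw [a2, b2, c2]; ring
  · rw [a3, b3, c3]; ring

end Structure

/-- `D = (∂₁Ω)² + (∂₂Ω)² + (∂₃Ω)²` is invariant under the three coordinate shifts by `2π`. [folklore] -/
theorem floor_D_shift (ω₂ : ℝ) (q : ℝ × ℝ × ℝ) (T : ℝ × ℝ × ℝ)
    (hT : T = (2 * Real.pi, 0, 0) ∨ T = (0, 2 * Real.pi, 0) ∨ T = (0, 0, 2 * Real.pi)) (v : ℝ × ℝ × ℝ) :
    fderiv ℝ (fun r : ℝ × ℝ × ℝ => resonanceFn ω₂ r.1 r.2.2 r.2.1) (q + T) v =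
      fderiv ℝ (fun r : ℝ × ℝ × ℝ => resonanceFn ω₂ r.1 r.2.2 r.2.1) q v := by
  obtain ⟨x, y, z⟩ := q
  rcases hT with h | h | h <;> subst h
  · have := fderiv_periodic₁ (F := fun r : ℝ × ℝ × ℝ => resonanceFn ω₂ r.1 r.2.2 r.2.1)
      (fun p => resonanceFn_cell_periodic_fst ω₂ p) (x, y, z) v
    simpa only [Prod.mk_add_mk, add_zero] using this
  · have := fderiv_periodic₂ (F := fun r : ℝ × ℝ × ℝ => resonanceFn ω₂ r.1 r.2.2 r.2.1)
      (fun p => resonanceFn_cell_periodic_mid ω₂ p) (x, y, z) v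
    simpa only [Prod.mk_add_mk, add_zero, zero_add] using this
  · have := fderiv_periodic₃ (F := fun r : ℝ × ℝ × ℝ => resonanceFn ω₂ r.1 r.2.2 r.2.1)
      (fun p => resonanceFn_cell_periodic_snd ω₂ p) (x, y, z) v
    simpa only [Prod.mk_add_mk, add_zero, zero_add] using this

/-! ### The global floor -/

/-- **Registered sub-goal `resonance_gradient_floor` of stub B1b″ (item (C4)): the Morse–Bott gradient floor
off the corner balls.** See the module docstring. [folklore] -/
theorem resonance_gradient_floor :
    ∀ ω₂ : ℝ, 0 < ω₂ → ∀ (A S₁ S₂ : ℝ × ℝ × ℝ → ℝ),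
      (∀ p : ℝ × ℝ × ℝ, S₁ p = Real.sin ((p.2.1 - p.1) / 2)) →
      (∀ p : ℝ × ℝ × ℝ, S₂ p = Real.sin ((p.2.1 - p.2.2) / 2)) →
      (∀ p : ℝ × ℝ × ℝ, A p =
        8 * ((dispersion ω₂ p.1 * dispersion ω₂ p.2.2 +
                dispersion ω₂ p.2.1 * dispersion ω₂ (p.1 + p.2.2 - p.2.1) + 2 * (ω₂ + 2)) *
              Real.cos ((p.1 + p.2.2) / 2) -
            4 * Real.cos ((p.2.1 - p.1) / 2) * Real.cos ((p.2.2 - p.2.1) / 2)) /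
          ((dispersion ω₂ p.1 + dispersion ω₂ p.2.2 + dispersion ω₂ p.2.1 + dispersion ω₂ (p.1 + p.2.2 - p.2.1)) *
            (dispersion ω₂ p.1 * dispersion ω₂ p.2.2 +
              dispersion ω₂ p.2.1 * dispersion ω₂ (p.1 + p.2.2 - p.2.1)))) →
      ∀ r₀ : ℝ, 0 < r₀ → ∃ c : ℝ, 0 < c ∧ ∀ p : ℝ × ℝ × ℝ,
        r₀ ≤ (1 - Real.cos p.1) + (1 - Real.cos p.2.2) + (1 + Real.cos p.2.1) →
        r₀ ≤ (1 + Real.cos p.1) + (1 + Real.cos p.2.2) + (1 - Real.cos p.2.1) →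
        c * (A p ^ 2 * S₁ p ^ 2 + A p ^ 2 * S₂ p ^ 2 + S₁ p ^ 2 * S₂ p ^ 2) ≤
          (fderiv ℝ (fun q : ℝ × ℝ × ℝ => resonanceFn ω₂ q.1 q.2.2 q.2.1) p (1, 0, 0)) ^ 2 +
            (fderiv ℝ (fun q : ℝ × ℝ × ℝ => resonanceFn ω₂ q.1 q.2.2 q.2.1) p (0, 1, 0)) ^ 2 +
            (fderiv ℝ (fun q : ℝ × ℝ × ℝ => resonanceFn ω₂ q.1 q.2.2 q.2.1) p (0, 0, 1)) ^ 2 := by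
  intro ω₂ hω A S₁ S₂ hS₁ hS₂ hA r₀ hr₀
  set Ω : ℝ × ℝ × ℝ → ℝ := fun q => resonanceFn ω₂ q.1 q.2.2 q.2.1 with hΩ
  set μ : ℝ × ℝ × ℝ → ℝ := fun p => A p ^ 2 * S₁ p ^ 2 + A p ^ 2 * S₂ p ^ 2 + S₁ p ^ 2 * S₂ p ^ 2 with hμdef
  set D : ℝ × ℝ × ℝ → ℝ := fun p => (fderiv ℝ Ω p (1, 0, 0)) ^ 2 + (fderiv ℝ Ω p (0, 1, 0)) ^ 2 +
    (fderiv ℝ Ω p (0, 0, 1)) ^ 2 with hDdef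
  set d₁ : ℝ × ℝ × ℝ → ℝ := fun p => (1 - Real.cos p.1) + (1 - Real.cos p.2.2) + (1 + Real.cos p.2.1) with hd₁
  set d₂ : ℝ × ℝ × ℝ → ℝ := fun p => (1 + Real.cos p.1) + (1 + Real.cos p.2.2) + (1 - Real.cos p.2.1) with hd₂
  show ∃ c : ℝ, 0 < c ∧ ∀ p : ℝ × ℝ × ℝ, r₀ ≤ d₁ p → r₀ ≤ d₂ p → c * μ p ≤ D p
  have hμ0 : ∀ p, 0 ≤ μ p := fun p => by rw [hμdef]; positivity
  -- the compact constraint set inside the closed cell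
  have c1 : Continuous fun p : ℝ × ℝ × ℝ => p.1 := continuous_fst
  have c3 : Continuous fun p : ℝ × ℝ × ℝ => p.2.1 := continuous_fst.comp continuous_snd
  have c2 : Continuous fun p : ℝ × ℝ × ℝ => p.2.2 := continuous_snd.comp continuous_snd
  have hd₁c : Continuous d₁ := by
    rw [hd₁]
    exact ((continuous_const.sub (Real.continuous_cos.comp c1)).add
      (continuous_const.sub (Real.continuous_cos.comp c2))).add (continuous_const.add (Real.continuous_cos.comp c3))
  have hd₂c : Continuous d₂ := by
    rw [hd₂]
    exact ((continuous_const.add (Real.continuous_cos.comp c1)).add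
      (continuous_const.add (Real.continuous_cos.comp c2))).add (continuous_const.sub (Real.continuous_cos.comp c3))
  set K : Set (ℝ × ℝ × ℝ) := (Icc (-Real.pi) (-Real.pi + 2 * Real.pi) ×ˢ (Icc (-Real.pi) (-Real.pi + 2 * Real.pi) ×ˢ
    Icc (-Real.pi) (-Real.pi + 2 * Real.pi))) ∩ ({p | r₀ ≤ d₁ p} ∩ {p | r₀ ≤ d₂ p}) with hKdef
  have hK : IsCompact K :=
    (isCompact_Icc.prod (isCompact_Icc.prod isCompact_Icc)).inter_right
      ((isClosed_le continuous_const hd₁c).inter (isClosed_le continuous_const hd₂c))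
  -- compactness patching of the local floors
  have hKfloor : ∃ c : ℝ, 0 < c ∧ ∀ p ∈ K, c * μ p ≤ D p := by
    refine hK.induction_on (p := fun S => ∃ c : ℝ, 0 < c ∧ ∀ p ∈ S, c * μ p ≤ D p) ⟨1, one_pos, fun p hp => hp.elim⟩
      (fun S T hST ⟨c, hc, h⟩ => ⟨c, hc, fun p hp => h p (hST hp)⟩)
      (fun S T ⟨c, hc, h⟩ ⟨c', hc', h'⟩ => ⟨min c c', lt_min hc hc', fun p hp => ?_⟩) (fun x hx => ?_)
    · rcases hp with hp | hp
      · exact (mul_le_mul_of_nonneg_right (min_le_left _ _) (hμ0 p)).trans (h p hp)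
      · exact (mul_le_mul_of_nonneg_right (min_le_right _ _) (hμ0 p)).trans (h' p hp)
    · have hx1 : d₁ x ≠ 0 := by have := hx.2.1; simp only [mem_setOf_eq] at this; intro h0; linarith
      have hx2 : d₂ x ≠ 0 := by have := hx.2.2; simp only [mem_setOf_eq] at this; intro h0; linarith
      obtain ⟨c, hc, hev⟩ := resonance_floor_local ω₂ hω A S₁ S₂ hS₁ hS₂ hA x hx1 hx2
      exact ⟨{p | c * μ p ≤ D p}, mem_nhdsWithin_of_mem_nhds hev, c, hc, fun p hp => hp⟩
  obtain ⟨c, hc, hcK⟩ := hKfloor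
  refine ⟨c, hc, ?_⟩
  -- periodicity
  have hP : ∀ p : ℝ × ℝ × ℝ, r₀ ≤ d₁ p → r₀ ≤ d₂ p → c * μ p ≤ D p := by
    refine forall_of_periodic3 (P := fun p => r₀ ≤ d₁ p → r₀ ≤ d₂ p → c * μ p ≤ D p) (a := -Real.pi)
      (T := 2 * Real.pi) (by positivity) (fun q => ?_) (fun q => ?_) (fun q => ?_) (fun q hq h1 h2 => ?_)
    · have hμq := floor_mu_shift hS₁ hS₂ hA q (2 * Real.pi, 0, 0) (Or.inl rfl)
      have hDq : D (q + (2 * Real.pi, 0, 0)) = D q := by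
        simp only [hDdef]
        rw [floor_D_shift ω₂ q (2 * Real.pi, 0, 0) (Or.inl rfl) (1, 0, 0), floor_D_shift ω₂ q (2 * Real.pi, 0, 0) (Or.inl rfl) (0, 1, 0),
          floor_D_shift ω₂ q (2 * Real.pi, 0, 0) (Or.inl rfl) (0, 0, 1)]
      have h1 : d₁ (q + (2 * Real.pi, 0, 0)) = d₁ q := by
        simp only [hd₁, Prod.fst_add, Prod.snd_add, add_zero, Real.cos_add_two_pi]
      have h2 : d₂ (q + (2 * Real.pi, 0, 0)) = d₂ q := by
        simp only [hd₂, Prod.fst_add, Prod.snd_add, add_zero, Real.cos_add_two_pi]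
      simp only [hμdef] at hμq ⊢
      rw [hμq, hDq, h1, h2]
    · have hμq := floor_mu_shift hS₁ hS₂ hA q (0, 2 * Real.pi, 0) (Or.inr (Or.inl rfl))
      have hDq : D (q + (0, 2 * Real.pi, 0)) = D q := by
        simp only [hDdef]
        rw [floor_D_shift ω₂ q (0, 2 * Real.pi, 0) (Or.inr (Or.inl rfl)) (1, 0, 0), floor_D_shift ω₂ q (0, 2 * Real.pi, 0) (Or.inr (Or.inl rfl)) (0, 1, 0),
          floor_D_shift ω₂ q (0, 2 * Real.pi, 0) (Or.inr (Or.inl rfl)) (0, 0, 1)]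
      have h1 : d₁ (q + (0, 2 * Real.pi, 0)) = d₁ q := by
        simp only [hd₁, Prod.fst_add, Prod.snd_add, add_zero, Real.cos_add_two_pi]
      have h2 : d₂ (q + (0, 2 * Real.pi, 0)) = d₂ q := by
        simp only [hd₂, Prod.fst_add, Prod.snd_add, add_zero, Real.cos_add_two_pi]
      simp only [hμdef] at hμq ⊢
      rw [hμq, hDq, h1, h2]
    · have hμq := floor_mu_shift hS₁ hS₂ hA q (0, 0, 2 * Real.pi) (Or.inr (Or.inr rfl))
      have hDq : D (q + (0, 0, 2 * Real.pi)) = D q := by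
        simp only [hDdef]
        rw [floor_D_shift ω₂ q (0, 0, 2 * Real.pi) (Or.inr (Or.inr rfl)) (1, 0, 0), floor_D_shift ω₂ q (0, 0, 2 * Real.pi) (Or.inr (Or.inr rfl)) (0, 1, 0),
          floor_D_shift ω₂ q (0, 0, 2 * Real.pi) (Or.inr (Or.inr rfl)) (0, 0, 1)]
      have h1 : d₁ (q + (0, 0, 2 * Real.pi)) = d₁ q := by
        simp only [hd₁, Prod.fst_add, Prod.snd_add, add_zero, Real.cos_add_two_pi]
      have h2 : d₂ (q + (0, 0, 2 * Real.pi)) = d₂ q := by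
        simp only [hd₂, Prod.fst_add, Prod.snd_add, add_zero, Real.cos_add_two_pi]
      simp only [hμdef] at hμq ⊢
      rw [hμq, hDq, h1, h2]
    · exact hcK q ⟨hq, h1, h2⟩
  exact hP

end Summit.AtomisticToContinuum.FouriersLaw.Theorems.DrudeDissolution.KineticPolymerGasOnTheTimeAxis

end
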